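import Summits.AtomisticToContinuum.HydrodynamicLimit.Theorems.TwoClocksEquilibriumFastWindowLDBirthT12Lorentz
import Summits.AtomisticToContinuum.HydrodynamicLimit.Theorems.TwoClocksEquilibriumFastWindowLDBirthT12LorentzB
import HarnessLib

/-!
# The true gain term on radial indicators against its Lorentz limit, uniformly in the threshold:
# the Kolmogorov-distance form of (e-K₂) in the zonal sector
# (helper `t12_gainTerm_indicator_sub_lorentz` of the line `birth`, crux `TwoClocks.EquilibriumFastWindowLD`,
# stmt-AtomisticToContinuum-14440; infrastructure (e-K₂), `ℓ = 0`, towards the registered analytic sub-goal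
# `t12_logLinearPreimage_and_dipoleModulus`)

Companion of `…T12Lorentz` (`lorentzGain`: the gain term with the Maxwellian partner frozen at rest,
`lorentzGain (f ∘ ‖·‖) v = π‖v‖ · 2∫₀¹ 2ρ f(ρ‖v‖) dρ`) and `…T12LorentzB` (`gainTerm`: the true gain term,
partner `w ∼ M`; comparison on the weights `1`, `‖x‖`). The (e-K₂) step of the corrector analysis (plan §5)
needs the true gain term on RADIAL test functions `u = G ∘ ‖·‖` with `G` ROUGH (bounded by an envelope, no
modulus of continuity): termwise Taylor comparison is then meaningless (the thermal partner shifts the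
argument of `G` by `O(1)`), and the comparison must be made between the two LAWS of the outgoing speed.
This file proves the distribution-function (Kolmogorov-distance) form of that comparison:

* `lorentzCdf a τ := (min a τ₊)²/a`, the distribution function of ONE Lorentz piece (mass `a`, radius `ρ a`,
  `ρ ∼ 2ρ dρ`): `a ∫₀¹ 2ρ 1{ρ a ≤ τ} dρ = lorentzCdf a τ` (`mul_integral_two_mul_indicator`), so that
  **`lorentzGain 1_{‖·‖ ≤ t} v = 2π lorentzCdf ‖v‖ t = 2π min (‖v‖, t₊²/‖v‖)`** (`lorentzGain_indicator`);
  `τ ↦ lorentzCdf a τ` is monotone and `2`-Lipschitz (`lorentzCdf_sub_mem`, density `2ρ ≤ 2`) and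
  `a ↦ lorentzCdf a τ` is `1`-Lipschitz (`abs_lorentzCdf_sub_lorentzCdf_le`, slopes `1` and `-τ²/a² ∈ [-1, 0]`).
* **The per-partner sandwich** `abs_sphereIntegral_indicator_sub_le`: for fixed `w`, `u = v - w`, the distance
  of either outgoing velocity `V ∈ {v', w'}` to the partner has EXACTLY the Lorentz radial law of speed `‖u‖`
  (`∫ (u·ω)₊ 1{‖V - w‖ ≤ τ} dσ = π lorentzCdf ‖u‖ τ`: radius laws `2ρ dρ` of `…T12Thales`,
  `sphereIntegral_hardSphereKernel_mul_indicator_radiusFst/Snd`), and `|‖V‖ - ‖V - w‖| ≤ ‖w‖`,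
  `|‖u‖ - ‖v‖| ≤ ‖w‖`; the two Lipschitz properties turn the shift and the rescaling into
  `|∫ (u·ω)₊ 1{‖V‖ ≤ t} dσ - π lorentzCdf ‖v‖ t| ≤ 3π‖w‖`, uniformly in `t`.
* Integrating `dM(w)` (`∫‖w‖ dM ≤ √3`): **registered `t12_gainTerm_indicator_sub_lorentz`**,
  **`|gainTerm 1_{‖·‖ ≤ t} v - 2π min (‖v‖, t₊²/‖v‖)| ≤ 6√3 π` for ALL `t ∈ ℝ`, `v ∈ ℝ³`** — the true radial
  law of the gain term (total mass `2ν(v) = 2π‖v‖ + O(1)`) is within Kolmogorov distance `O(1)` of the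
  Lorentz radial law `2π‖v‖ · 2ρ dρ ∘ (ρ ↦ ρ‖v‖)⁻¹`, i.e. RELATIVE distance `O(1/‖v‖)`, with an absolute
  constant and no regularity whatsoever. CLASS COVERED: indicators of balls (distribution functions),
  hence — by linearity/positivity of both operators (`lorentzGain_add/const_mul/mono`, and the analogous
  Bochner manipulations of `gainTerm`) and Abel summation — radial step functions `Σ cᵢ 1_{‖·‖ ≤ tᵢ}`
  with error `6√3π Σ|cᵢ|`, and by layer-cake every radial `G ∘ ‖·‖` with `G` of bounded variation on
  `[0, ‖v‖]` at cost `O(Var G)` plus the tail beyond `‖v‖` (sibling file `…T12GainRadialB`: scale stability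
  for rough `G` of linear growth, survival-function form, tail moment `gainTerm (‖·‖ - ‖v‖)₊ v = O(1 + ‖v‖)`).

[folklore] (far-field / Lorentz-gas limit of the hard-sphere gain term at large speed: Grad 1963 §4;
Cercignani–Illner–Pulvirenti 1994 §7.2; the law-comparison formulation is FACT F / (e-K₂) of the
corrector-growth plan of the line `birth`).
-/

noncomputable section

open MeasureTheory ProbabilityTheory Real Set Filter Metric
open scoped ENNReal BigOperators InnerProductSpace
namespace Summit.AtomisticToContinuum.HydrodynamicLimit.Theorems.ClampedCorrectorBirth

open Literature.Analysis.FluidPDE Literature.MathematicalPhysics.KineticTheory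
open Literature.Analysis.UnboundedOperators

/-! ### The Lorentz radial distribution function `L(a, τ) = (min a τ₊)² / a` -/

/-- **The Lorentz radial distribution function** `lorentzCdf a τ = (min a τ₊)²/a` (`τ₊ = max τ 0`): the
flux-weighted mass of `{ρ a ≤ τ}` under the radius law `2ρ dρ` on `[0, 1]` scaled to total mass `a`,
`a ∫₀¹ 2ρ 1{ρ a ≤ τ} dρ = min (a, τ₊²/a)` (`mul_integral_two_mul_indicator`); `lorentzCdf 0 τ = 0`. [folklore] -/
def lorentzCdf (a τ : ℝ) : ℝ := (min a (max τ 0)) ^ 2 / a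

/-- `lorentzCdf 0 τ = 0`. [folklore] -/
theorem lorentzCdf_zero_left (τ : ℝ) : lorentzCdf 0 τ = 0 := by
  simp [lorentzCdf]

/-- `0 ≤ lorentzCdf a τ` for `0 ≤ a`. [folklore] -/
theorem lorentzCdf_nonneg {a : ℝ} (ha : 0 ≤ a) (τ : ℝ) : 0 ≤ lorentzCdf a τ :=
  div_nonneg (sq_nonneg _) ha

/-- `lorentzCdf a τ ≤ a` for `0 ≤ a` (total mass). [folklore] -/
theorem lorentzCdf_le {a : ℝ} (ha : 0 ≤ a) (τ : ℝ) : lorentzCdf a τ ≤ a := by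
  rcases ha.eq_or_lt with rfl | ha'
  · rw [lorentzCdf_zero_left]
  rw [lorentzCdf, div_le_iff₀ ha']
  have h1 : 0 ≤ min a (max τ 0) := le_min ha (le_max_right _ _)
  have h2 : min a (max τ 0) ≤ a := min_le_left _ _
  nlinarith

/-- The clamp `τ ↦ min a τ₊` is `1`-Lipschitz. [folklore] -/
theorem abs_min_max_sub_min_max_le (a τ₁ τ₂ : ℝ) :
    |min a (max τ₁ 0) - min a (max τ₂ 0)| ≤ |τ₁ - τ₂| :=
  calc |min a (max τ₁ 0) - min a (max τ₂ 0)| ≤ max |a - a| |max τ₁ 0 - max τ₂ 0| :=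
        abs_min_sub_min_le_max _ _ _ _
    _ ≤ |τ₁ - τ₂| := by
        rw [sub_self, abs_zero]
        exact max_le (abs_nonneg _) (abs_max_sub_max_le_abs _ _ _)

/-- **(F2) `τ ↦ lorentzCdf a τ` is monotone and `2`-Lipschitz**: for `0 ≤ a` and `τ₁ ≤ τ₂`,
`0 ≤ lorentzCdf a τ₂ - lorentzCdf a τ₁ ≤ 2 (τ₂ - τ₁)` (density `2ρ ≤ 2`). [folklore] -/
theorem lorentzCdf_sub_mem {a : ℝ} (ha : 0 ≤ a) {τ₁ τ₂ : ℝ} (hτ : τ₁ ≤ τ₂) :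
    0 ≤ lorentzCdf a τ₂ - lorentzCdf a τ₁ ∧ lorentzCdf a τ₂ - lorentzCdf a τ₁ ≤ 2 * (τ₂ - τ₁) := by
  rcases ha.eq_or_lt with rfl | ha'
  · rw [lorentzCdf_zero_left, lorentzCdf_zero_left, sub_self]
    exact ⟨le_rfl, by linarith⟩
  set q₁ := min a (max τ₁ 0) with hq₁
  set q₂ := min a (max τ₂ 0) with hq₂
  have h01 : 0 ≤ q₁ := le_min ha (le_max_right _ _)
  have h2a : q₂ ≤ a := min_le_left _ _
  have hmono : q₁ ≤ q₂ := min_le_min_left _ (max_le_max_right 0 hτ)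
  have hlip : q₂ - q₁ ≤ τ₂ - τ₁ := by
    have h := abs_min_max_sub_min_max_le a τ₂ τ₁
    rw [abs_of_nonneg (sub_nonneg.2 hmono), abs_of_nonneg (sub_nonneg.2 hτ)] at h
    exact h
  have hsub : lorentzCdf a τ₂ - lorentzCdf a τ₁ = (q₂ - q₁) * (q₂ + q₁) / a := by
    simp only [lorentzCdf, ← hq₁, ← hq₂]
    rw [div_sub_div_same]
    ring
  rw [hsub]
  refine ⟨div_nonneg (mul_nonneg (sub_nonneg.2 hmono) (by linarith)) ha, ?_⟩
  rw [div_le_iff₀ ha']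
  nlinarith [mul_le_mul_of_nonneg_left (show q₂ + q₁ ≤ 2 * a by linarith) (sub_nonneg.2 hmono)]

/-- **(F3) `a ↦ lorentzCdf a τ` is `1`-Lipschitz on `[0, ∞)`**, ordered form: for `0 ≤ a ≤ b`,
`|lorentzCdf a τ - lorentzCdf b τ| ≤ b - a` (`a ↦ min (a, p²/a)` has slopes `1` and `-p²/a² ∈ [-1, 0]`).
[folklore] -/
theorem abs_lorentzCdf_sub_lorentzCdf_le_of_le {a b : ℝ} (ha : 0 ≤ a) (hab : a ≤ b) (τ : ℝ) :
    |lorentzCdf a τ - lorentzCdf b τ| ≤ b - a := by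
  set p := max τ 0 with hp
  have hp0 : 0 ≤ p := le_max_right _ _
  have hb : 0 ≤ b := ha.trans hab
  rcases ha.eq_or_lt with rfl | ha'
  · rw [lorentzCdf_zero_left, zero_sub, abs_neg, abs_of_nonneg (lorentzCdf_nonneg hb τ), sub_zero]
    exact lorentzCdf_le hb τ
  have hb' : 0 < b := ha'.trans_le hab
  simp only [lorentzCdf, ← hp]
  rcases le_total p a with hpa | hpa
  · -- `p ≤ a ≤ b`: `p²/a - p²/b = p² (b - a)/(a b) ≤ b - a`
    rw [min_eq_right hpa, min_eq_right (hpa.trans hab), div_sub_div _ _ ha'.ne' hb'.ne', abs_div,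
      abs_of_pos (mul_pos ha' hb'), div_le_iff₀ (mul_pos ha' hb')]
    rw [show p ^ 2 * b - a * p ^ 2 = p ^ 2 * (b - a) by ring, abs_of_nonneg (by nlinarith)]
    have : p ^ 2 ≤ a * b := by nlinarith
    nlinarith [sub_nonneg.2 hab]
  rcases le_total p b with hpb | hpb
  · -- `a ≤ p ≤ b`: `|a - p²/b| ≤ b - a`
    rw [min_eq_left hpa, min_eq_right hpb, show a ^ 2 / a = a by rw [sq, mul_div_cancel_right₀ _ ha'.ne'],
      abs_le]
    constructor
    · -- `p²/b - a ≤ b - a` since `p² ≤ b²`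
      have h1 : p ^ 2 / b ≤ b := by rw [div_le_iff₀ hb']; nlinarith
      linarith
    · -- `a - p²/b ≤ b - a` since `b + p²/b ≥ 2p ≥ 2a`
      have h1 : 2 * p - b ≤ p ^ 2 / b := by rw [le_div_iff₀ hb']; nlinarith [sq_nonneg (p - b)]
      linarith
  · -- `a ≤ b ≤ p`
    rw [min_eq_left hpa, min_eq_left hpb, show a ^ 2 / a = a by rw [sq, mul_div_cancel_right₀ _ ha'.ne'],
      show b ^ 2 / b = b by rw [sq, mul_div_cancel_right₀ _ hb'.ne'], abs_sub_comm, abs_of_nonneg (sub_nonneg.2 hab)]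

/-- **(F3) `a ↦ lorentzCdf a τ` is `1`-Lipschitz on `[0, ∞)`.** [folklore] -/
theorem abs_lorentzCdf_sub_lorentzCdf_le {a b : ℝ} (ha : 0 ≤ a) (hb : 0 ≤ b) (τ : ℝ) :
    |lorentzCdf a τ - lorentzCdf b τ| ≤ |a - b| := by
  rcases le_total a b with hab | hba
  · rw [abs_sub_comm a b, abs_of_nonneg (sub_nonneg.2 hab)]
    exact abs_lorentzCdf_sub_lorentzCdf_le_of_le ha hab τ
  · rw [abs_sub_comm, abs_of_nonneg (sub_nonneg.2 hba)]
    exact abs_lorentzCdf_sub_lorentzCdf_le_of_le hb hba τ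

/-- **(F1) The radius law on indicators**: for `0 ≤ a`,
`a ∫₀¹ 2ρ · 1_{(-∞, τ]}(ρ a) dρ = lorentzCdf a τ`. [folklore] -/
theorem mul_integral_two_mul_indicator {a : ℝ} (ha : 0 ≤ a) (τ : ℝ) :
    a * ∫ ρ in (0:ℝ)..1, 2 * ρ * (Iic τ).indicator (fun _ => (1:ℝ)) (ρ * a) = lorentzCdf a τ := by
  rcases ha.eq_or_lt with rfl | ha'
  · rw [zero_mul, lorentzCdf_zero_left]
  rcases lt_or_ge τ 0 with hτ | hτ
  · -- the indicator vanishes on `[0, 1]`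
    have h0 : ∫ ρ in (0:ℝ)..1, 2 * ρ * (Iic τ).indicator (fun _ => (1:ℝ)) (ρ * a) = 0 := by
      refine intervalIntegral.integral_zero_ae (Eventually.of_forall fun ρ hρ => ?_)
      rw [uIoc_of_le zero_le_one] at hρ
      rw [indicator_of_notMem, mul_zero]
      exact fun h : ρ * a ≤ τ => by nlinarith [hρ.1, mul_nonneg hρ.1.le ha]
    rw [h0, mul_zero, lorentzCdf, max_eq_right hτ.le, min_eq_right ha, sq, zero_mul, zero_div]
  · set c := min 1 (τ / a) with hc
    have hc0 : 0 ≤ c := le_min zero_le_one (div_nonneg hτ ha)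
    have hc1 : c ≤ 1 := min_le_left _ _
    have hcong : ∫ ρ in (0:ℝ)..1, 2 * ρ * (Iic τ).indicator (fun _ => (1:ℝ)) (ρ * a) =
        ∫ ρ in (0:ℝ)..1, {x | x ≤ c}.indicator (fun ρ => 2 * ρ) ρ := by
      refine intervalIntegral.integral_congr fun ρ hρ => ?_
      rw [uIcc_of_le zero_le_one] at hρ
      by_cases h : ρ * a ≤ τ
      · have hρc : ρ ≤ c := le_min hρ.2 ((le_div_iff₀ ha').2 h)
        rw [indicator_of_mem (show ρ * a ∈ Iic τ from h), indicator_of_mem (show ρ ∈ {x | x ≤ c} from hρc),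
          mul_one]
      · have hρc : ¬ ρ ≤ c := fun h' => h ((le_div_iff₀ ha').1 (h'.trans (min_le_right _ _)))
        rw [indicator_of_notMem (show ρ * a ∉ Iic τ from h), indicator_of_notMem (show ρ ∉ {x | x ≤ c} from hρc),
          mul_zero]
    rw [hcong, intervalIntegral.integral_indicator ⟨hc0, hc1⟩, intervalIntegral.integral_const_mul, integral_id,
      lorentzCdf, max_eq_left hτ]
    have hmin : min a τ = a * c := by
      rw [hc, mul_min_of_nonneg _ _ ha, mul_one, mul_div_cancel₀ _ ha'.ne']
    rw [hmin]
    field_simp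
    ring

/-- **The Lorentz operator on radial indicators**: `lorentzGain 1_{‖·‖ ≤ t} v = 2π · lorentzCdf ‖v‖ t`
`= 2π min (‖v‖, t₊²/‖v‖)` — the distribution function of the Lorentz radial law (two pieces of mass `π‖v‖`,
radius `ρ‖v‖`, `ρ ∼ 2ρ dρ`). [folklore] -/
theorem lorentzGain_indicator (t : ℝ) (v : EuclideanSpace ℝ (Fin 3)) :
    lorentzGain (fun x => (Iic t).indicator (fun _ => (1:ℝ)) ‖x‖) v = 2 * π * lorentzCdf ‖v‖ t := by
  rw [lorentzGain_radial v (f := fun r : ℝ => (Iic t).indicator (fun _ => (1:ℝ)) r)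
    (measurable_const.indicator measurableSet_Iic), ← mul_integral_two_mul_indicator (norm_nonneg v) t]
  ring

/-! ### The radius laws on indicators and the per-partner sandwich -/

variable {v w : EuclideanSpace ℝ (Fin 3)}

/-- Indicators of half-lines are monotone under implications of the thresholds. [folklore] -/
theorem indicator_Iic_le_indicator_Iic {a b x y : ℝ} (h : x ≤ a → y ≤ b) :
    (Iic a).indicator (fun _ => (1:ℝ)) x ≤ (Iic b).indicator (fun _ => (1:ℝ)) y := by
  by_cases hx : x ≤ a
  · rw [indicator_of_mem (show x ∈ Iic a from hx), indicator_of_mem (show y ∈ Iic b from h hx)]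
  · rw [indicator_of_notMem (show x ∉ Iic a from hx)]
    exact indicator_nonneg (fun _ _ => zero_le_one) _

/-- `0 ≤ 1_{(-∞, a]}(x) ≤ 1`. [folklore] -/
theorem indicator_Iic_mem (a x : ℝ) :
    0 ≤ (Iic a).indicator (fun _ => (1:ℝ)) x ∧ (Iic a).indicator (fun _ => (1:ℝ)) x ≤ 1 :=
  ⟨indicator_nonneg (fun _ _ => zero_le_one) _, indicator_le_self' (fun _ _ => zero_le_one) _⟩

/-- **Radius law of the own particle on indicators**: `∫ (u·ω)₊ 1{‖v' - w‖ ≤ τ} dσ = π · lorentzCdf ‖v - w‖ τ`.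
[folklore] -/
theorem sphereIntegral_hardSphereKernel_mul_indicator_radiusFst (v w : EuclideanSpace ℝ (Fin 3)) (τ : ℝ) :
    ∫ ω, hardSphereKernel (v, w) ω * (Iic τ).indicator (fun _ => (1:ℝ)) ‖(collide ω (v, w)).1 - w‖ ∂sphereMeasure =
      π * lorentzCdf ‖v - w‖ τ := by
  rcases eq_or_ne v w with rfl | hvw
  · simp [hardSphereKernel, lorentzCdf_zero_left]
  have hs : ‖v - w‖ ≠ 0 := norm_ne_zero_iff.2 (sub_ne_zero.2 hvw)
  have hF : AEStronglyMeasurable (fun ρ : ℝ => (Iic τ).indicator (fun _ => (1:ℝ)) (ρ * ‖v - w‖))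
      (volume.restrict (Icc (0:ℝ) 1)) :=
    ((measurable_const.indicator measurableSet_Iic).comp (measurable_id.mul_const _)).aestronglyMeasurable
  have h := integral_hardSphereKernel_smul_comp_radiusFst v w hF
  simp only [smul_eq_mul, div_mul_cancel₀ _ hs] at h
  rw [h, mul_assoc, mul_integral_two_mul_indicator (norm_nonneg _)]

/-- **Radius law of the partner particle on indicators**: `∫ (u·ω)₊ 1{‖w' - w‖ ≤ τ} dσ = π · lorentzCdf ‖v - w‖ τ`.
[folklore] -/
theorem sphereIntegral_hardSphereKernel_mul_indicator_radiusSnd (v w : EuclideanSpace ℝ (Fin 3)) (τ : ℝ) :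
    ∫ ω, hardSphereKernel (v, w) ω * (Iic τ).indicator (fun _ => (1:ℝ)) ‖(collide ω (v, w)).2 - w‖ ∂sphereMeasure =
      π * lorentzCdf ‖v - w‖ τ := by
  rcases eq_or_ne v w with rfl | hvw
  · simp [hardSphereKernel, lorentzCdf_zero_left]
  have hs : ‖v - w‖ ≠ 0 := norm_ne_zero_iff.2 (sub_ne_zero.2 hvw)
  have hF : AEStronglyMeasurable (fun ρ : ℝ => (Iic τ).indicator (fun _ => (1:ℝ)) (ρ * ‖v - w‖))
      (volume.restrict (Icc (0:ℝ) 1)) :=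
    ((measurable_const.indicator measurableSet_Iic).comp (measurable_id.mul_const _)).aestronglyMeasurable
  have h := integral_hardSphereKernel_smul_comp_radiusSnd v w hF
  simp only [smul_eq_mul, div_mul_cancel₀ _ hs] at h
  rw [h, mul_assoc, mul_integral_two_mul_indicator (norm_nonneg _)]

/-- A flux-weighted indicator is integrable on the sphere. [folklore] -/
theorem integrable_hardSphereKernel_mul_indicator {f : sphere (0 : EuclideanSpace ℝ (Fin 3)) 1 → ℝ}
    (hf : Measurable f) (a : ℝ) :
    Integrable (fun ω => hardSphereKernel (v, w) ω * (Iic a).indicator (fun _ => (1:ℝ)) (f ω))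
      (sphereMeasure : Measure (sphere (0 : EuclideanSpace ℝ (Fin 3)) 1)) := by
  have hBm : Measurable fun ω : sphere (0 : EuclideanSpace ℝ (Fin 3)) 1 => hardSphereKernel (v, w) ω := by
    unfold hardSphereKernel; fun_prop
  refine integrable_sphere_of_bound (hBm.mul ((measurable_const.indicator measurableSet_Iic).comp hf))
    (K := ‖v - w‖) fun ω => ?_
  have hB0 : 0 ≤ hardSphereKernel (v, w) ω := le_max_right _ _
  rw [abs_mul, abs_of_nonneg hB0, abs_of_nonneg (indicator_Iic_mem a _).1]
  exact (mul_le_of_le_one_right hB0 (indicator_Iic_mem a _).2).trans (hardSphereKernel_le_norm v w ω)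

/-- **The per-partner sandwich.** For a measurable transported velocity `V` (`v'` or `w'`) whose distance to
the partner has the Lorentz radial law, `∫ (u·ω)₊ 1{‖V - w‖ ≤ τ} dσ = π lorentzCdf ‖u‖ τ` for all `τ`:
`|∫ (u·ω)₊ 1{‖V‖ ≤ t} dσ - π lorentzCdf ‖v‖ t| ≤ 3π‖w‖` — the shift `|‖V‖ - ‖V - w‖| ≤ ‖w‖` costs `2π‖w‖`
(F2), the rescaling `|‖u‖ - ‖v‖| ≤ ‖w‖` costs `π‖w‖` (F3); NO regularity is involved. [folklore] -/
theorem abs_sphereIntegral_indicator_sub_le (t : ℝ) {V : sphere (0 : EuclideanSpace ℝ (Fin 3)) 1 → EuclideanSpace ℝ (Fin 3)}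
    (hV : Measurable V)
    (hrad : ∀ τ, ∫ ω, hardSphereKernel (v, w) ω * (Iic τ).indicator (fun _ => (1:ℝ)) ‖V ω - w‖ ∂sphereMeasure =
      π * lorentzCdf ‖v - w‖ τ) :
    |∫ ω, hardSphereKernel (v, w) ω * (Iic t).indicator (fun _ => (1:ℝ)) ‖V ω‖ ∂sphereMeasure -
        π * lorentzCdf ‖v‖ t| ≤ 3 * π * ‖w‖ := by
  have hB0 : ∀ ω, 0 ≤ hardSphereKernel (v, w) ω := fun ω => le_max_right _ _
  have hlo : π * lorentzCdf ‖v - w‖ (t - ‖w‖) ≤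
      ∫ ω, hardSphereKernel (v, w) ω * (Iic t).indicator (fun _ => (1:ℝ)) ‖V ω‖ ∂sphereMeasure := by
    rw [← hrad]
    refine integral_mono (integrable_hardSphereKernel_mul_indicator (hV.sub_const w).norm _)
      (integrable_hardSphereKernel_mul_indicator hV.norm _) fun ω => mul_le_mul_of_nonneg_left
        (indicator_Iic_le_indicator_Iic fun h => ?_) (hB0 ω)
    linarith [norm_sub_norm_le (V ω) w]
  have hhi : ∫ ω, hardSphereKernel (v, w) ω * (Iic t).indicator (fun _ => (1:ℝ)) ‖V ω‖ ∂sphereMeasure ≤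
      π * lorentzCdf ‖v - w‖ (t + ‖w‖) := by
    rw [← hrad]
    refine integral_mono (integrable_hardSphereKernel_mul_indicator hV.norm _)
      (integrable_hardSphereKernel_mul_indicator (hV.sub_const w).norm _) fun ω => mul_le_mul_of_nonneg_left
        (indicator_Iic_le_indicator_Iic fun h => ?_) (hB0 ω)
    linarith [norm_sub_le (V ω) w]
  have h2a := (lorentzCdf_sub_mem (norm_nonneg (v - w)) (show t ≤ t + ‖w‖ by linarith [norm_nonneg w])).2
  have h2b := (lorentzCdf_sub_mem (norm_nonneg (v - w)) (show t - ‖w‖ ≤ t by linarith [norm_nonneg w])).2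
  have h3 : |lorentzCdf ‖v - w‖ t - lorentzCdf ‖v‖ t| ≤ ‖w‖ :=
    (abs_lorentzCdf_sub_lorentzCdf_le (norm_nonneg _) (norm_nonneg _) t).trans
      (by simpa using abs_norm_sub_norm_le (v - w) v)
  rw [abs_le] at h3 ⊢
  constructor <;> nlinarith [pi_pos, h3.1, h3.2]

/-! ### Integration against the Maxwellian partner -/

/-- `|1_{(-∞, t]}(‖x‖)| ≤ 1 · e^{‖x‖²/4}`: indicators have Gaussian growth. [folklore] -/
theorem abs_indicator_norm_le_exp (t : ℝ) (x : EuclideanSpace ℝ (Fin 3)) :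
    |(Iic t).indicator (fun _ => (1:ℝ)) ‖x‖| ≤ 1 * Real.exp (‖x‖ ^ 2 / 4) := by
  rw [abs_of_nonneg (indicator_Iic_mem t _).1, one_mul]
  exact (indicator_Iic_mem t _).2.trans (Real.one_le_exp (by positivity))

/-- **One piece, integrated**: for a measurable transported velocity `P (w, ω)` (`v'` or `w'`) with
`‖P‖² ≤ ‖v‖² + ‖w‖²` and the Lorentz radial law of `‖P - w‖` for every partner `w`:
`|∫ dM(w) ∫ (u·ω)₊ 1{‖P‖ ≤ t} dσ - π lorentzCdf ‖v‖ t| ≤ 3√3 π` (`∫ ‖w‖ dM ≤ √3`). [folklore] -/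
theorem abs_gainPiece_indicator_sub_le (v : EuclideanSpace ℝ (Fin 3)) (t : ℝ)
    {P : EuclideanSpace ℝ (Fin 3) × sphere (0 : EuclideanSpace ℝ (Fin 3)) 1 → EuclideanSpace ℝ (Fin 3)}
    (hPm : Measurable P) (hP : ∀ w ω, ‖P (w, ω)‖ ^ 2 ≤ ‖v‖ ^ 2 + ‖w‖ ^ 2)
    (hrad : ∀ w τ, ∫ ω, hardSphereKernel (v, w) ω * (Iic τ).indicator (fun _ => (1:ℝ)) ‖P (w, ω) - w‖ ∂sphereMeasure =
      π * lorentzCdf ‖v - w‖ τ) :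
    |(∫ w, ∫ ω, hardSphereKernel (v, w) ω * (Iic t).indicator (fun _ => (1:ℝ)) ‖P (w, ω)‖ ∂sphereMeasure
        ∂stdGaussian (EuclideanSpace ℝ (Fin 3))) - π * lorentzCdf ‖v‖ t| ≤ 3 * Real.sqrt 3 * π := by
  obtain ⟨-, hI⟩ := integrable_kernel_mul_comp_of_gaussGrowth
    (ψ := fun x : EuclideanSpace ℝ (Fin 3) => (Iic t).indicator (fun _ => (1:ℝ)) ‖x‖)
    ((measurable_const.indicator measurableSet_Iic).comp measurable_norm) (abs_indicator_norm_le_exp t) v hPm hP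
  obtain ⟨hnorm, h3, -, -⟩ := integral_norm_moments_stdGaussian_le v
  have hconst : ∫ _w, π * lorentzCdf ‖v‖ t ∂stdGaussian (EuclideanSpace ℝ (Fin 3)) = π * lorentzCdf ‖v‖ t := by
    rw [integral_const, probReal_univ, one_smul]
  rw [← hconst, ← integral_sub hI (integrable_const _)]
  calc |∫ w, ((∫ ω, hardSphereKernel (v, w) ω * (Iic t).indicator (fun _ => (1:ℝ)) ‖P (w, ω)‖ ∂sphereMeasure) -
          π * lorentzCdf ‖v‖ t) ∂stdGaussian (EuclideanSpace ℝ (Fin 3))|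
      ≤ ∫ w, 3 * π * ‖w‖ ∂stdGaussian (EuclideanSpace ℝ (Fin 3)) := by
        rw [← Real.norm_eq_abs]
        refine norm_integral_le_of_norm_le (hnorm.const_mul _) (Eventually.of_forall fun w => ?_)
        rw [Real.norm_eq_abs]
        exact abs_sphereIntegral_indicator_sub_le t (hPm.comp measurable_prodMk_left) (hrad w)
    _ ≤ 3 * Real.sqrt 3 * π := by
        rw [integral_const_mul]
        nlinarith [pi_pos]

/-- **The true gain term on radial indicators against its Lorentz limit, uniformly in the threshold**:
`|gainTerm 1_{‖·‖ ≤ t} v - 2π lorentzCdf ‖v‖ t| ≤ 6√3 π` for ALL `t` and `v`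
(`2π lorentzCdf ‖v‖ t = lorentzGain 1_{‖·‖ ≤ t} v`, `lorentzGain_indicator`). [folklore] -/
theorem abs_gainTerm_indicator_sub_lorentz (t : ℝ) (v : EuclideanSpace ℝ (Fin 3)) :
    |gainTerm (fun x => (Iic t).indicator (fun _ => (1:ℝ)) ‖x‖) v - 2 * π * lorentzCdf ‖v‖ t| ≤
      6 * Real.sqrt 3 * π := by
  obtain ⟨m1, m2⟩ := measurable_collide_param v
  have h1 := abs_gainPiece_indicator_sub_le v t m1 (fun w ω => (norm_sq_collide_le ω v w).1)
    fun w τ => sphereIntegral_hardSphereKernel_mul_indicator_radiusFst v w τ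
  have h2 := abs_gainPiece_indicator_sub_le v t m2 (fun w ω => (norm_sq_collide_le ω v w).2)
    fun w τ => sphereIntegral_hardSphereKernel_mul_indicator_radiusSnd v w τ
  rw [abs_le] at h1 h2 ⊢
  unfold gainTerm
  constructor <;> linarith [h1.1, h1.2, h2.1, h2.2]

/-- The same with the Lorentz operator: `|gainTerm 1_{‖·‖ ≤ t} v - lorentzGain 1_{‖·‖ ≤ t} v| ≤ 6√3 π`. [folklore] -/
theorem abs_gainTerm_sub_lorentzGain_indicator (t : ℝ) (v : EuclideanSpace ℝ (Fin 3)) :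
    |gainTerm (fun x => (Iic t).indicator (fun _ => (1:ℝ)) ‖x‖) v -
        lorentzGain (fun x => (Iic t).indicator (fun _ => (1:ℝ)) ‖x‖) v| ≤ 6 * Real.sqrt 3 * π := by
  rw [lorentzGain_indicator]
  exact abs_gainTerm_indicator_sub_lorentz t v

/-! ### Registered helper -/

/-- **Registered helper `t12_gainTerm_indicator_sub_lorentz` — the true gain term on radial indicators against
its Lorentz limit, uniformly in the threshold (Kolmogorov-distance form of (e-K₂), zonal sector).** For every
`t ∈ ℝ` and `v ∈ ℝ³` (`M = stdGaussian`, `σ` the surface measure of `S²`, `(v', w') = collide ω (v, w)`):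
`|∫ dM(w) ∫_{S²} ((v-w)·ω)₊ 1{‖v'‖ ≤ t} dσ(ω) + ∫ dM(w) ∫_{S²} ((v-w)·ω)₊ 1{‖w'‖ ≤ t} dσ(ω) - 2π (min (‖v‖, t₊))²/‖v‖| ≤ 6√3 π`,
i.e. `gainTerm 1_{‖·‖ ≤ t} v = lorentzGain 1_{‖·‖ ≤ t} v + O(1)` with `lorentzGain 1_{‖·‖ ≤ t} v = 2π min (‖v‖, t₊²/‖v‖)`
(`lorentzGain_indicator`; two Lorentz pieces of mass `π‖v‖`, radius `ρ‖v‖`, `ρ ∼ 2ρ dρ`): the distribution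
function of the outgoing speed under the true flux⊗Maxwellian law is uniformly `O(1)`-close to the Lorentz one
(total masses `2ν(v)` vs `2π‖v‖`, so RELATIVE Kolmogorov distance `O(1/‖v‖)`). Mechanism: per partner `w` the
distance of `v'`, `w'` to `w` has exactly the Lorentz radial law of speed `‖v - w‖`; the shift
`|‖v'‖ - ‖v' - w‖| ≤ ‖w‖` costs `2π‖w‖` (the Lorentz distribution function is `2`-Lipschitz in the threshold),
the rescaling `|‖v - w‖ - ‖v‖| ≤ ‖w‖` costs `π‖w‖` (`1`-Lipschitz in the speed), and `∫‖w‖ dM ≤ √3`. No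
regularity of the test function enters — the regularity-free core of (e-K₂) of the corrector-growth plan. [folklore] -/
theorem t12_gainTerm_indicator_sub_lorentz : ∀ (t : ℝ) (v : EuclideanSpace ℝ (Fin 3)), |(∫ w, ∫ ω, Literature.MathematicalPhysics.KineticTheory.hardSphereKernel (v, w) ω * Set.indicator (Set.Iic t) (fun _ => (1:ℝ)) ‖(Literature.MathematicalPhysics.KineticTheory.collide ω (v, w)).1‖ ∂Literature.MathematicalPhysics.KineticTheory.sphereMeasure ∂ProbabilityTheory.stdGaussian (EuclideanSpace ℝ (Fin 3))) + (∫ w, ∫ ω, Literature.MathematicalPhysics.KineticTheory.hardSphereKernel (v, w) ω * Set.indicator (Set.Iic t) (fun _ => (1:ℝ)) ‖(Literature.MathematicalPhysics.KineticTheory.collide ω (v, w)).2‖ ∂Literature.MathematicalPhysics.KineticTheory.sphereMeasure ∂ProbabilityTheory.stdGaussian (EuclideanSpace ℝ (Fin 3))) - 2 * Real.pi * ((min ‖v‖ (max t 0)) ^ 2 / ‖v‖)| ≤ 6 * Real.sqrt 3 * Real.pi :=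
  fun t v => abs_gainTerm_indicator_sub_lorentz t v

end Summit.AtomisticToContinuum.HydrodynamicLimit.Theorems.ClampedCorrectorBirth

end
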